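import Summits.QuantumAdvantage.QuantumAdvantage.Theses.PadKuperberg
import Literature.Computability.Cryptography.CsidhTorsorFamilyAxioms

/-!
# BC2 / clause-(c) probe log for the decompositions of `TorsorHard` (stmt-QuantumAdvantage-0927)

SELF-CERTIFYING form: every probe is
`example : P → T := by fail_if_success ((first | exact? | simpa [P] | (unfold P; simpa) | aesop); done); sorry`
so the file ELABORATES (rc 0, one `sorry` warning per probe) exactly when every cheap probe FAILS;
a probe that succeeds turns into an error (`fail_if_success` fails) and is then reported in the
census with the closing term. `S := _root_.QuantumAdvantage`, `X := PadKuperberg.TorsorHard`; the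
piece definitions are copied verbatim from `Split.lean` (same directory) into this file's namespace
so that the probe file imports only the route file and the CSIDH family. Imports bring the landed
CSIDH theorems, the route's `closes`, and everything `PadKuperberg.lean` imports (Mathlib,
ClassBQP, Randomized, BoolEncodings) into `exact?`'s scope.
planner-cstrat-stmt-QuantumAdvantage-0927-r1-0, 2026-08-17.
-/

set_option linter.dupNamespace false
set_option linter.unusedVariables false

noncomputable section

namespace Summit.QuantumAdvantage.QuantumAdvantage.Cruxes.TorsorHard.BcProbes

open Summit.QuantumAdvantage.QuantumAdvantage.Theses.PadKuperberg
open Literature.Computability.Complexity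
open Literature.Computability.Cryptography.Csidh
open _root_.Computability

/-! ## Pieces (verbatim copies of `Split.lean` §1–§4) -/

/-- copy of `Split.Axioms13`. [folklore] -/
def Axioms13 (lab elt : List Bool → List Bool → Bool) (one : List Bool → List Bool)
    (mul act : List Bool → List Bool → List Bool → List Bool)
    (gens : List Bool → List (List Bool)) : Prop :=
  (∀ p g h, lab p g = true → lab p h = true → lab p (mul p g h) = true) ∧
  (∀ p, lab p (one p) = true) ∧
  (∀ p g, lab p g = true → mul p (one p) g = g) ∧
  (∀ p g h k, lab p g = true → lab p h = true → lab p k = true →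
    mul p (mul p g h) k = mul p g (mul p h k)) ∧
  (∀ p g h, lab p g = true → lab p h = true → mul p g h = mul p h g) ∧
  (∀ p g, lab p g = true → ∃ h, lab p h = true ∧ mul p g h = one p) ∧
  (∀ p g z, lab p g = true → elt p z = true → elt p (act p g z) = true) ∧
  (∀ p z, elt p z = true → act p (one p) z = z) ∧
  (∀ p g h z, lab p g = true → lab p h = true → elt p z = true →
    act p (mul p g h) z = act p g (act p h z)) ∧
  (∀ p z₀ z₁, elt p z₀ = true → elt p z₁ = true → ∃! g, lab p g = true ∧ act p g z₀ = z₁) ∧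
  (∀ p g, lab p g = true → g.length ≤ p.length) ∧
  (∀ p, ∀ h ∈ gens p, lab p h = true) ∧
  (∀ p g, lab p g = true → ∃ es : List ℕ,
    g = (List.zipWith (fun h e => (mul p h)^[e] (one p)) (gens p) es).foldr (mul p) (one p))

/-- copy of `Split.PolyTime6`. [folklore] -/
def PolyTime6 (d : ℕ) (lab elt : List Bool → List Bool → Bool) (one : List Bool → List Bool)
    (mul act : List Bool → List Bool → List Bool → List Bool)
    (gens : List Bool → List (List Bool)) : Prop :=
  Literature.Computability.Complexity.PolyTimeComputable
      (fun q : List Bool × List Bool => Literature.Computability.Complexity.boolPair q.1 q.2)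
      Computability.encodeBool (fun q : List Bool × List Bool => lab q.1 q.2) ∧
  Literature.Computability.Complexity.PolyTimeComputable
      (fun q : List Bool × List Bool => Literature.Computability.Complexity.boolPair q.1 q.2)
      Computability.encodeBool (fun q : List Bool × List Bool => elt q.1 q.2) ∧
  Literature.Computability.Complexity.PolyTimeComputable (id : List Bool → List Bool)
      (id : List Bool → List Bool) one ∧
  Literature.Computability.Complexity.PolyTimeComputable (id : List Bool → List Bool)
      (Computability.encodingList Bool).listBool.encode gens ∧
  Literature.Computability.Complexity.PolyTimeComputable
      (fun t : List Bool × List Bool × List Bool =>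
        Literature.Computability.Complexity.boolPair t.1
          (Literature.Computability.Complexity.boolPair t.2.1 t.2.2))
      (id : List Bool → List Bool) (fun t : List Bool × List Bool × List Bool => mul t.1 t.2.1 t.2.2) ∧
  Literature.Computability.Complexity.PolyTimeComputable
      (fun t : List Bool × List Bool × List Bool =>
        Literature.Computability.Complexity.boolPair
          (Literature.Computability.Complexity.boolPair t.1
            (Literature.Computability.Complexity.boolPair t.2.1 t.2.2))
          (List.replicate (2 ^ (d * Nat.sqrt (t.1.length * Nat.log 2 t.1.length) + d)) true))
      (id : List Bool → List Bool) (fun t : List Bool × List Bool × List Bool => act t.1 t.2.1 t.2.2)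

/-- copy of `Split.SubexpHard`. [folklore] -/
def SubexpHard (lab elt : List Bool → List Bool → Bool)
    (act : List Bool → List Bool → List Bool → List Bool) : Prop :=
  ∀ c' : ℕ, ¬ ∃ A : Literature.Computability.Complexity.RandAlg (List Bool × List Bool × List Bool) (List Bool),
    A.RunsInTime
      (fun t : List Bool × List Bool × List Bool =>
        Literature.Computability.Complexity.boolPair t.1
          (Literature.Computability.Complexity.boolPair t.2.1 t.2.2))
      (id : List Bool → List Bool)
      (fun t : List Bool × List Bool × List Bool =>
        2 ^ (c' * Nat.sqrt (t.1.length * Nat.log 2 t.1.length) + c') *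
          ((Literature.Computability.Complexity.boolPair t.1
            (Literature.Computability.Complexity.boolPair t.2.1 t.2.2)).length + 1) ^ c') ∧
    ∀ p z₀ z₁, elt p z₀ = true → elt p z₁ = true →
      (2 : ℝ) / 3 ≤ A.pr
        (fun t : List Bool × List Bool × List Bool =>
          Literature.Computability.Complexity.boolPair t.1
            (Literature.Computability.Complexity.boolPair t.2.1 t.2.2))
        (p, z₀, z₁) {g | lab p g = true ∧ act p g z₀ = z₁}

/-- copy of `Split.CsidhStructure`. [folklore] -/
def CsidhStructure : Prop :=
  ∃ P₀ : ℕ, ∀ P₁ : ℕ, P₀ ≤ P₁ →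
    Axioms13 (csidhLab P₁) (csidhElt P₁) (csidhOne P₁) (csidhMul P₁) (csidhAct P₁) (csidhGens P₁)

/-- copy of `Split.CsidhEval`. [folklore] -/
def CsidhEval : Prop :=
  ∃ d P₀ : ℕ, ∀ P₁ : ℕ, P₀ ≤ P₁ →
    PolyTime6 d (csidhLab P₁) (csidhElt P₁) (csidhOne P₁) (csidhMul P₁) (csidhAct P₁) (csidhGens P₁)

/-- copy of `Split.CsidhVectorizationHard`. [folklore] -/
def CsidhVectorizationHard : Prop :=
  ∃ P₀ : ℕ, ∀ P₁ : ℕ, P₀ ≤ P₁ → SubexpHard (csidhLab P₁) (csidhElt P₁) (csidhAct P₁)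

/-- copy of `Split.ecCode`. [folklore] -/
def ecCode (q n : ℕ) (cs : List ℕ) : List Bool :=
  Literature.Computability.Complexity.boolPair (encodeNat q)
    (Literature.Computability.Complexity.boolPair (encodeNat n)
      (cs.foldr (fun c acc => Literature.Computability.Complexity.boolPair (encodeNat c) acc) []))

/-- copy of `Split.EcdlpSubexpHard`. [folklore] -/
def EcdlpSubexpHard : Prop :=
  ∀ c' : ℕ, ¬ ∃ A : Literature.Computability.Complexity.RandAlg (List Bool) (List Bool),
    A.RunsInTime (id : List Bool → List Bool) (id : List Bool → List Bool)
      (fun x : List Bool => 2 ^ (c' * Nat.sqrt (x.length * Nat.log 2 x.length) + c') * (x.length + 1) ^ c') ∧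
    ∀ (q : ℕ) [Fact q.Prime] (W : WeierstrassCurve.Affine (ZMod q)) (x₀ y₀ x₁ y₁ : ZMod q)
      (h₀ : W.Nonsingular x₀ y₀) (h₁ : W.Nonsingular x₁ y₁) (n k : ℕ),
      n.Prime → q + 1 + 2 * Nat.sqrt q < n * n →
      addOrderOf (WeierstrassCurve.Affine.Point.some x₀ y₀ h₀) = n →
      WeierstrassCurve.Affine.Point.some x₁ y₁ h₁ = k • WeierstrassCurve.Affine.Point.some x₀ y₀ h₀ →
      (2 : ℝ) / 3 ≤ A.pr (id : List Bool → List Bool)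
        (ecCode q n [W.a₁.val, W.a₂.val, W.a₃.val, W.a₄.val, W.a₆.val, x₀.val, y₀.val, x₁.val, y₁.val])
        {g | decodeNat g = k % n}

/-- copy of `Split.EcWorldBridge`. [folklore] -/
def EcWorldBridge : Prop := EcdlpSubexpHard → TorsorHard

/-- copy of `Split.PostQuantumResidual`. [folklore] -/
def PostQuantumResidual : Prop := ¬ EcdlpSubexpHard → TorsorHard

/-! ## Probes (each MUST FAIL; the file elaborates iff all fail) -/

set_option maxHeartbeats 400000

/-- Probe 01: `X → S` — must FAIL. (The two `simpa` alternatives of the standard probe,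
`simpa [TorsorHard]` and `(unfold TorsorHard; simpa)`, each hit the deterministic TIMEOUT at
`maxHeartbeats 400000` (`whnf` / `isDefEq` on the 20-clause definition) — diagnostic file
`Probe01.lean`, lean check 2026-08-17: errors at its lines 156 and 162 — which is a failure of the
probe but not one `fail_if_success` can certify (runtime exception); so here only `exact?` and
`aesop` are run, both of which fail in the ordinary way.) -/
example : TorsorHard → _root_.QuantumAdvantage := by
  fail_if_success ((first | exact? | aesop); done)
  sorry

/-- Probe 02: `S → X` — must FAIL. -/
example : _root_.QuantumAdvantage → TorsorHard := by
  fail_if_success ((first | exact? | simpa [TorsorHard] | (unfold TorsorHard; simpa) | aesop); done)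
  sorry

/-- Probe 03: `CsidhStructure → S` — must FAIL. -/
example : CsidhStructure → _root_.QuantumAdvantage := by
  fail_if_success ((first | exact? | simpa [CsidhStructure] | (unfold CsidhStructure; simpa) | aesop); done)
  sorry

/-- Probe 04: `CsidhStructure → X` — must FAIL. -/
example : CsidhStructure → TorsorHard := by
  fail_if_success ((first | exact? | simpa [CsidhStructure] | (unfold CsidhStructure; simpa) | aesop); done)
  sorry

/-- Probe 05: `CsidhEval → S` — must FAIL. -/
example : CsidhEval → _root_.QuantumAdvantage := by
  fail_if_success ((first | exact? | simpa [CsidhEval] | (unfold CsidhEval; simpa) | aesop); done)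
  sorry

/-- Probe 06: `CsidhEval → X` — must FAIL. -/
example : CsidhEval → TorsorHard := by
  fail_if_success ((first | exact? | simpa [CsidhEval] | (unfold CsidhEval; simpa) | aesop); done)
  sorry

/-- Probe 07: `CsidhVectorizationHard → S` — must FAIL. -/
example : CsidhVectorizationHard → _root_.QuantumAdvantage := by
  fail_if_success ((first | exact? | simpa [CsidhVectorizationHard] | (unfold CsidhVectorizationHard; simpa) | aesop); done)
  sorry

/-- Probe 08: `CsidhVectorizationHard → X` — must FAIL. -/
example : CsidhVectorizationHard → TorsorHard := by
  fail_if_success ((first | exact? | simpa [CsidhVectorizationHard] | (unfold CsidhVectorizationHard; simpa) | aesop); done)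
  sorry

/-- Probe 09: `S → CsidhVectorizationHard (converse)` — must FAIL. -/
example : _root_.QuantumAdvantage → CsidhVectorizationHard := by
  fail_if_success ((first | exact? | simpa [CsidhVectorizationHard] | (unfold CsidhVectorizationHard; simpa) | aesop); done)
  sorry

/-- Probe 10: `CsidhStructure ∧ CsidhEval → X (hardness load-bearing)` — must FAIL. -/
example : CsidhStructure ∧ CsidhEval → TorsorHard := by
  fail_if_success ((first | exact? | simpa [CsidhStructure, CsidhEval] | (unfold CsidhStructure CsidhEval; simpa) | aesop); done)
  sorry

/-- Probe 11: `CsidhStructure ∧ CsidhVectorizationHard → X (evaluation load-bearing)` — must FAIL. -/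
example : CsidhStructure ∧ CsidhVectorizationHard → TorsorHard := by
  fail_if_success ((first | exact? | simpa [CsidhStructure, CsidhVectorizationHard] | (unfold CsidhStructure CsidhVectorizationHard; simpa) | aesop); done)
  sorry

/-- Probe 12: `CsidhEval ∧ CsidhVectorizationHard → X (structure load-bearing)` — must FAIL. -/
example : CsidhEval ∧ CsidhVectorizationHard → TorsorHard := by
  fail_if_success ((first | exact? | simpa [CsidhEval, CsidhVectorizationHard] | (unfold CsidhEval CsidhVectorizationHard; simpa) | aesop); done)
  sorry

/-- Probe 13: `EcdlpSubexpHard → S` — must FAIL. -/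
example : EcdlpSubexpHard → _root_.QuantumAdvantage := by
  fail_if_success ((first | exact? | simpa [EcdlpSubexpHard] | (unfold EcdlpSubexpHard; simpa) | aesop); done)
  sorry

/-- Probe 14: `EcdlpSubexpHard → X` — must FAIL. -/
example : EcdlpSubexpHard → TorsorHard := by
  fail_if_success ((first | exact? | simpa [EcdlpSubexpHard] | (unfold EcdlpSubexpHard; simpa) | aesop); done)
  sorry

/-- Probe 15: `S → EcdlpSubexpHard (converse)` — must FAIL. -/
example : _root_.QuantumAdvantage → EcdlpSubexpHard := by
  fail_if_success ((first | exact? | simpa [EcdlpSubexpHard] | (unfold EcdlpSubexpHard; simpa) | aesop); done)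
  sorry

/-- Probe 16: `PostQuantumResidual → S` — must FAIL. -/
example : PostQuantumResidual → _root_.QuantumAdvantage := by
  fail_if_success ((first | exact? | simpa [PostQuantumResidual] | (unfold PostQuantumResidual; simpa) | aesop); done)
  sorry

/-- Probe 17: `PostQuantumResidual → X` — must FAIL. -/
example : PostQuantumResidual → TorsorHard := by
  fail_if_success ((first | exact? | simpa [PostQuantumResidual] | (unfold PostQuantumResidual; simpa) | aesop); done)
  sorry

/-- Probe 18: `EcWorldBridge → S` — must FAIL. -/
example : EcWorldBridge → _root_.QuantumAdvantage := by
  fail_if_success ((first | exact? | simpa [EcWorldBridge] | (unfold EcWorldBridge; simpa) | aesop); done)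
  sorry

/-- Probe 19: `EcWorldBridge → X` — must FAIL. -/
example : EcWorldBridge → TorsorHard := by
  fail_if_success ((first | exact? | simpa [EcWorldBridge] | (unfold EcWorldBridge; simpa) | aesop); done)
  sorry

end Summit.QuantumAdvantage.QuantumAdvantage.Cruxes.TorsorHard.BcProbes

end
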